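import Mathlib
import Literature.Analysis.Approximation.SchurInequality
import HarnessLib

/-!
# Route TaylorCertificates — `PacketLemma`, helper 1: the Bernstein–Szegő difference inequality

A one-dimensional tool for the proof of
`Summit.AnomalousDissipation.AnomalousDissipation.Theses.TaylorCertificates.PacketLemma`
(item stmt-AnomalousDissipation-14032): for a real trigonometric polynomial
`f(t) = Re ∑_k c_k e^{2πi m_k t}` of degree `≤ D` (`|m_k| ≤ D`) and period `1` with `|f| ≤ B`,

  `|f(a) - f(b)| ≤ 2 D B |sin(π (a - b))|`   for all real `a`, `b`.

Proof (M. Riesz's device, as in the reduction of Bernstein's inequality to Schur's lemma;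
Borwein–Erdélyi, *Polynomials and Polynomial Inequalities*, §5.1): the odd part
`S(φ) = f(c₀ + φ/2π) - f(c₀ - φ/2π)` is `sin φ · P(cos φ)` with `P = ∑ β_k U_{m_k - 1}` (Chebyshev
polynomials of the second kind, `deg P < D`), `|P(y)| √(1-y²) = |S(arccos y)| ≤ 2B` on `[-1,1]`,
so Schur's inequality (`Literature.Analysis.Approximation.schur_inequality`, proved in tree) gives
`|P| ≤ 2 D B` on `[-1,1]`, whence `|S(φ)| ≤ 2 D B |sin φ|`. No derivatives are involved.

No new definitions; no named facts.
-/

noncomputable section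

open Polynomial Real

namespace Summit.AnomalousDissipation.AnomalousDissipation.Theorems

-- the mandated namespace `Summit.<Summit>.<Problem>.Theorems` repeats `AnomalousDissipation` (single-problem summit)
set_option linter.dupNamespace false

/-- The exponential `e^{2πi m (c + u)} - e^{2πi m (c - u)} = e^{2πi m c} · 2i sin(2π m u)`. [folklore] -/
theorem cexp_add_sub_cexp_sub (m : ℤ) (c u : ℝ) :
    Complex.exp (2 * π * Complex.I * m * ((c + u : ℝ) : ℂ)) -
        Complex.exp (2 * π * Complex.I * m * ((c - u : ℝ) : ℂ)) =
      Complex.exp (2 * π * Complex.I * m * (c : ℂ)) *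
        (2 * ((Real.sin (2 * π * m * u) : ℝ) : ℂ) * Complex.I) := by
  have h1 : Complex.exp (2 * π * Complex.I * m * ((c + u : ℝ) : ℂ)) =
      Complex.exp (2 * π * Complex.I * m * c) * Complex.exp (((2 * π * m * u : ℝ) : ℂ) * Complex.I) := by
    rw [← Complex.exp_add]; congr 1; push_cast; ring
  have h2 : Complex.exp (2 * π * Complex.I * m * ((c - u : ℝ) : ℂ)) =
      Complex.exp (2 * π * Complex.I * m * c) * Complex.exp (((-(2 * π * m * u) : ℝ) : ℂ) * Complex.I) := by
    rw [← Complex.exp_add]; congr 1; push_cast; ring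
  rw [h1, h2, ← mul_sub, Complex.exp_mul_I, Complex.exp_mul_I]
  congr 1
  rw [← Complex.ofReal_cos, ← Complex.ofReal_sin, ← Complex.ofReal_cos, ← Complex.ofReal_sin,
    Real.cos_neg, Real.sin_neg]
  push_cast
  ring

/-- Degree bound for the Chebyshev polynomials of the second kind entering the odd-part device:
`deg U_{m-1} < D` whenever `|m| ≤ D`. [folklore] -/
theorem degree_U_sub_one_lt {m : ℤ} {D : ℕ} (hm : m.natAbs ≤ D) :
    (Polynomial.Chebyshev.U ℝ (m - 1)).degree < D := by
  by_cases h0 : Polynomial.Chebyshev.U ℝ (m - 1) = 0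
  · rw [h0, Polynomial.degree_zero]; exact WithBot.bot_lt_coe D
  · have hm1 : m - 1 ≠ -1 := fun h => h0 (by rw [h, Polynomial.Chebyshev.U_neg_one])
    have hm0 : m ≠ 0 := fun h => hm1 (by rw [h]; ring)
    rw [Polynomial.degree_eq_natDegree h0, Polynomial.Chebyshev.natDegree_U, sub_add_cancel]
    have h1 : 1 ≤ m.natAbs := Int.natAbs_pos.2 hm0
    exact_mod_cast (show m.natAbs - 1 < D by omega)

/-- **Bernstein–Szegő difference inequality** for real trigonometric polynomials of period `1`:
if `f(t) = Re ∑_{k∈K} c_k e^{2πi m_k t}` with all `|m_k| ≤ D` and `|f| ≤ B` everywhere, then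
`|f(a) - f(b)| ≤ 2 D B |sin(π(a-b))|` (M. Riesz's odd-part device and Schur's inequality;
Borwein–Erdélyi, GTM 161, §5.1, E.5). [folklore] -/
theorem abs_sub_le_of_trigSum {ι : Type*} (K : Finset ι) (m : ι → ℤ) (c : ι → ℂ) {D : ℕ}
    (hm : ∀ k ∈ K, (m k).natAbs ≤ D) {f : ℝ → ℝ}
    (hf : ∀ t, f t = (∑ k ∈ K, c k * Complex.exp (2 * π * Complex.I * (m k) * t)).re)
    {B : ℝ} (hB : ∀ t, |f t| ≤ B) (a b : ℝ) :
    |f a - f b| ≤ 2 * D * B * |Real.sin (π * (a - b))| := by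
  classical
  set c₀ : ℝ := (a + b) / 2 with hc₀
  -- the coefficients of the odd part and the polynomial `P`
  set β : ι → ℝ := fun k => -2 * (c k * Complex.exp (2 * π * Complex.I * (m k) * c₀)).im with hβ
  set P : ℝ[X] := ∑ k ∈ K, β k • Polynomial.Chebyshev.U ℝ (m k - 1) with hP
  -- the odd part is `sin φ · P(cos φ)`
  have hS : ∀ φ : ℝ, f (c₀ + φ / (2 * π)) - f (c₀ - φ / (2 * π)) =
      Real.sin φ * P.eval (Real.cos φ) := by
    intro φ
    rw [hf, hf, ← Complex.sub_re, ← Finset.sum_sub_distrib, hP, Polynomial.eval_finsetSum,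
      Finset.mul_sum, Complex.re_sum]
    refine Finset.sum_congr rfl fun k _ => ?_
    rw [← mul_sub, cexp_add_sub_cexp_sub (m k) c₀ (φ / (2 * π))]
    have hsin : Real.sin (2 * π * (m k) * (φ / (2 * π))) =
        (Polynomial.Chebyshev.U ℝ (m k - 1)).eval (Real.cos φ) * Real.sin φ := by
      rw [Polynomial.Chebyshev.U_real_cos]
      congr 1; push_cast; field_simp; ring
    rw [hsin, Polynomial.eval_smul, smul_eq_mul]
    have hre : ∀ (z : ℂ) (r : ℝ), (z * (2 * (r : ℂ) * Complex.I)).re = -2 * z.im * r := by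
      intro z r
      simp [Complex.mul_re, Complex.mul_im]
      ring
    rw [← mul_assoc, hre, hβ]
    ring
  -- `|S| ≤ 2B`
  have hSB : ∀ φ : ℝ, |Real.sin φ * P.eval (Real.cos φ)| ≤ 2 * B := fun φ => by
    rw [← hS]
    exact (abs_sub _ _).trans (by linarith [hB (c₀ + φ / (2 * π)), hB (c₀ - φ / (2 * π))])
  -- degree of `P`
  have hdeg : P.degree < D := by
    rw [hP]
    refine lt_of_le_of_lt (Polynomial.degree_sum_le _ _) ?_
    refine (Finset.sup_lt_iff (WithBot.bot_lt_coe D)).2 fun k hk => ?_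
    exact (Polynomial.degree_smul_le _ _).trans_lt (degree_U_sub_one_lt (hm k hk))
  -- Schur's hypothesis on `[-1, 1]`
  have hSchur : ∀ y ∈ Set.Icc (-1 : ℝ) 1, |P.eval y| * √(1 - y ^ 2) ≤ 2 * B := by
    intro y hy
    have h := hSB (Real.arccos y)
    rwa [Real.cos_arccos hy.1 hy.2, Real.sin_arccos, abs_mul, abs_of_nonneg (Real.sqrt_nonneg _),
      mul_comm] at h
  -- conclude
  have hcos : Real.cos (π * (a - b)) ∈ Set.Icc (-1 : ℝ) 1 :=
    ⟨Real.neg_one_le_cos _, Real.cos_le_one _⟩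
  have hPb := Literature.Analysis.Approximation.schur_inequality hdeg hSchur hcos
  have hab : f a - f b = Real.sin (π * (a - b)) * P.eval (Real.cos (π * (a - b))) := by
    have ha : c₀ + π * (a - b) / (2 * π) = a := by rw [hc₀]; field_simp; ring
    have hb : c₀ - π * (a - b) / (2 * π) = b := by rw [hc₀]; field_simp; ring
    rw [← hS, ha, hb]
  rw [hab, abs_mul]
  have hs0 : 0 ≤ |Real.sin (π * (a - b))| := abs_nonneg _
  calc |Real.sin (π * (a - b))| * |P.eval (Real.cos (π * (a - b)))|
      ≤ |Real.sin (π * (a - b))| * (D * (2 * B)) := mul_le_mul_of_nonneg_left hPb hs0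
    _ = 2 * D * B * |Real.sin (π * (a - b))| := by ring

end Summit.AnomalousDissipation.AnomalousDissipation.Theorems
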